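import Literature.Topology.FourManifolds.KhCurlArcs
import Literature.Topology.FourManifolds.KhFlipDegree
import Literature.Topology.FourManifolds.LeeRasmussenProofs
import HarnessLib

/-!
# The curl of the first Reidemeister move: enhanced states and their degrees

Sibling file of `KhComplex.lean`, continuing `KhCurlArcs` in the invariance programme for
`Literature.Topology.FourManifolds.GaussDiagram.nonempty_iso_khovanovHomology_of_equiv`
(Khovanov (2000), Thm. 1; first Reidemeister move: Khovanov (2000), §5.1–5.2, Bar-Natan (2002),
§4). For the curled diagram `G.curl tf ε` (curl of sign `ε` at the last two positions) we
describe the generators of the cube complex, i.e. the enhanced states, over those of `G`: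

* `curlSeifBit ε` — Seifert's smoothing of the curl chord (`0` for a positive, `1` for a negative
  curl), the one in which the loop of the curl is a separate state circle (`KhCurlArcs`);
* `curlLoopES s x` — the enhanced state of the curled diagram over the enhanced state `s` of `G`
  with the curl resolved à la Seifert and its loop labelled `x` (the generators of
  `C(D ⊔ ○) = C(D) ⊗ A`), and `curlThruES s` — the one with the curl resolved the other way
  (the generators of the copy of `C(D)`); `curlProjES` — the enhanced state of `G` under an
  enhanced state of the curled diagram; `curlESEquiv` — **together these are all the enhanced
  states of the curled diagram**: `ES(G.curl) ≃ ES(G) × Bool ⊕ ES(G)` (Khovanov (2000), §5.1: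
  `C(D') = C(D ⊔ ○) ⊕ C(D)[-1]` as groups; Bar-Natan (2002), §4);
* the state circles: `curlThruCircleEquiv` (resolving the curl against Seifert changes no
  circle), `curlLoopCircleEquiv` (resolving it à la Seifert adds the loop), with the labels of
  the circles (`circleLabel_curlThruES`, `circleLabel_curlLoopES`);
* **the degrees**: `homDegree_curlLoopES`, `homDegree_curlThruES` (`+ε`), `qDegree_curlLoopES`
  (`+ deg x + ε`), `qDegree_curlThruES` (`+ 2ε`) — the grading shifts of Khovanov (2000), §5.1–5.2
  / Bar-Natan (2002), §4 in the normalisation `homDegree = |s| - n₋`,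
  `qDegree = deg + |s| + n₊ - 2n₋` of `KhComplex`.

Everything is proved, for every Gauss diagram; no named fact is introduced.

## References

* M. Khovanov, *A categorification of the Jones polynomial*, Duke Math. J. 101 (2000) 359–426,
  §5.1–5.2 (the complexes of a diagram with a curl). [cite: Khovanov2000, §5.1]
* D. Bar-Natan, *On Khovanov's categorification of the Jones polynomial*, Algebr. Geom. Topol. 2
  (2002) 337–370, §4 (invariance under `R1`), §3.2 (gradings). [cite: BarNatan2002, §4]
* O. Viro, *Khovanov homology, its definitions and ramifications*, Fund. Math. 184 (2004), §5.1
  (enhanced states). [cite: Viro2004, §5.1]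
-/

open Function Set

noncomputable section

namespace Literature.Topology.FourManifolds

namespace GaussDiagram

variable (G : GaussDiagram) (tf : Bool) (ε : ℤˣ)

/-! ## Seifert's smoothing of the curl -/

/-- **Seifert's smoothing of the curl chord** of sign `ε`: the `0`-smoothing for a positive curl,
the `1`-smoothing for a negative one — the smoothing in which the loop of the curl is a state
circle by itself. Bar-Natan (2002), §3.1; Khovanov (2000), §5.1–5.2. [cite: BarNatan2002, §3.1] -/
def curlSeifBit (ε : ℤˣ) : Bool := !(ε == 1)

/-- `curlSeifBit` is Seifert's smoothing. [folklore] -/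
@[simp]
theorem curlSeif_curlSeifBit (ε : ℤˣ) : curlSeif (curlSeifBit ε) ε = true := by
  rcases Int.units_eq_one_or ε with rfl | rfl <;> decide

/-- The other smoothing is not Seifert's. [folklore] -/
@[simp]
theorem curlSeif_not_curlSeifBit (ε : ℤˣ) : curlSeif (!curlSeifBit ε) ε = false := by
  rcases Int.units_eq_one_or ε with rfl | rfl <;> decide

/-- A smoothing of the curl is Seifert's iff it is `curlSeifBit`. [folklore] -/
theorem curlSeif_eq_true_iff (b : Bool) (ε : ℤˣ) : curlSeif b ε = true ↔ b = curlSeifBit ε := by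
  rcases Int.units_eq_one_or ε with rfl | rfl <;> cases b <;> decide

/-- A smoothing of the curl is not Seifert's iff it is the other one. [folklore] -/
theorem curlSeif_eq_false_iff (b : Bool) (ε : ℤˣ) : curlSeif b ε = false ↔ b = !curlSeifBit ε := by
  rcases Int.units_eq_one_or ε with rfl | rfl <;> cases b <;> decide

/-- Seifert's smoothing of a positive curl is the `0`-smoothing. [folklore] -/
@[simp] theorem curlSeifBit_one : curlSeifBit 1 = false := by decide

/-- Seifert's smoothing of a negative curl is the `1`-smoothing. [folklore] -/
@[simp] theorem curlSeifBit_neg_one : curlSeifBit (-1) = true := by decide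

/-! ## Lifting the arcs of `G` to the curled diagram -/

/-- **A lift of the arcs of `G` to arcs of the curled diagram off the loop**: an arc keeps its
number, except that the subdivided arc `baseArc` is lifted to its outgoing half. [folklore] -/
def curlLift (a : G.Arc) : (G.curl tf ε).Arc :=
  ⟨if a.val < 2 * G.n - 1 then a.val else 2 * G.n + 1, by
    have := a.isLt; unfold arcCount at this ⊢; simp only [curl_n]; split_ifs <;> omega⟩

/-- Lifting then projecting an arc gives it back. [folklore] -/
@[simp]
theorem curlProj_curlLift (a : G.Arc) : G.curlProj tf ε (G.curlLift tf ε a) = a := by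
  apply Fin.ext
  have := a.isLt
  unfold arcCount at this
  simp only [val_curlProj, curlLift]
  split_ifs <;> omega

/-- Lifted arcs are off the loop. [folklore] -/
theorem curlLift_ne_curlLoop (a : G.Arc) : G.curlLift tf ε a ≠ G.curlLoop tf ε := fun h ↦ by
  have h' := congrArg Fin.val h
  simp only [curlLift, val_curlLoop] at h'
  split_ifs at h' <;> omega

/-- An arc off the loop lies on the state circle of the lift of its projection. [folklore] -/
theorem reachable_curlLift_curlProj (σ : G.State) (b : Bool) {x : (G.curl tf ε).Arc}
    (hx : x ≠ G.curlLoop tf ε) :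
    ((G.curl tf ε).stateGraph (G.curlState tf ε σ b)).Reachable
      (G.curlLift tf ε (G.curlProj tf ε x)) x :=
  G.reachable_curl_of_curlProj_eq tf ε σ b (G.curlLift_ne_curlLoop tf ε _) hx (by simp)

/-- Outside Seifert's smoothing of the curl, every arc lies on the state circle of the lift of its
projection. [folklore] -/
theorem reachable_curlLift_curlProj_of_not_seif (σ : G.State) (b : Bool)
    (hS : curlSeif b ε = false) (x : (G.curl tf ε).Arc) :
    ((G.curl tf ε).stateGraph (G.curlState tf ε σ b)).Reachable
      (G.curlLift tf ε (G.curlProj tf ε x)) x := by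
  by_cases hx : x = G.curlLoop tf ε
  · subst hx
    refine (G.reachable_curl_of_curlProj_eq tf ε σ b (G.curlLift_ne_curlLoop tf ε _)
      (G.curlLoop_ne_curlOut tf ε).symm (by simp)).trans
      (G.reachable_curlLoop_curlOut tf ε σ b hS).symm
  · exact G.reachable_curlLift_curlProj tf ε σ b hx

/-! ## Enhanced states of the curled diagram -/

variable {G}

/-- **The enhanced state of the curled diagram over `s` with the curl resolved à la Seifert and
its loop labelled `x`** (a generator of `C(D ⊔ ○) ≅ C(D) ⊗ A` inside `C(D')`): old smoothings
and labels those of `s`, the curl chord smoothed by `curlSeifBit ε`, the loop — a state circle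
by itself — labelled `x`. Khovanov (2000), §5.1–5.2; Bar-Natan (2002), §4. [cite: Khovanov2000, §5.1] -/
def curlLoopES (s : G.EnhancedState) (x : Bool) : (G.curl tf ε).EnhancedState where
  state := G.curlState tf ε s.state (curlSeifBit ε)
  label a := if a = G.curlLoop tf ε then x else s.label (G.curlProj tf ε a)
  label_eq a a' hadj := by
    obtain ⟨h1, h2⟩ := (G.circleOf_curl_eq_iff_of_seif tf ε s.state (curlSeifBit ε)
      (curlSeif_curlSeifBit ε) a a').1 (circleOf_eq_iff.2 hadj.reachable)
    by_cases ha : a = G.curlLoop tf ε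
    · rw [if_pos ha, if_pos (h1.1 ha)]
    · rw [if_neg ha, if_neg (fun h' ↦ ha (h1.2 h'))]
      exact s.label_eq_of_circleOf_eq (h2 ha)

/-- **The enhanced state of the curled diagram over `s` with the curl resolved against Seifert**
(a generator of the copy of `C(D)` inside `C(D')`): old smoothings those of `s`, the curl chord
smoothed by `!curlSeifBit ε`, every arc labelled as the old arc containing it (the loop is
inserted in the through strand). Khovanov (2000), §5.1–5.2; Bar-Natan (2002), §4.
[cite: Khovanov2000, §5.1] -/
def curlThruES (s : G.EnhancedState) : (G.curl tf ε).EnhancedState where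
  state := G.curlState tf ε s.state (!curlSeifBit ε)
  label a := s.label (G.curlProj tf ε a)
  label_eq _ _ hadj :=
    s.label_eq_of_reachable (G.reachable_curlProj tf ε s.state _ hadj.reachable)

/-- **The enhanced state of `G` under an enhanced state of the curled diagram**: forget the
smoothing of the curl and read the label of an old arc on its lift. [folklore] -/
def curlProjES (s' : (G.curl tf ε).EnhancedState) : G.EnhancedState where
  state j := s'.state j.castSucc
  label a := s'.label (G.curlLift tf ε a)
  label_eq a a' hadj := by
    apply s'.label_eq_of_reachable
    rw [G.eq_curlState tf ε s'.state]
    exact G.reachable_curl_of_reachable tf ε _ _ hadj.reachable (G.curlLift_ne_curlLoop tf ε a)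
      (G.curlLift_ne_curlLoop tf ε a') (by simp) (by simp)

/-- The state of `curlLoopES s x`. [folklore] -/
@[simp]
theorem curlLoopES_state (s : G.EnhancedState) (x : Bool) :
    (curlLoopES tf ε s x).state = G.curlState tf ε s.state (curlSeifBit ε) := rfl

/-- The loop of `curlLoopES s x` is labelled `x`. [folklore] -/
@[simp]
theorem curlLoopES_label_curlLoop (s : G.EnhancedState) (x : Bool) :
    (curlLoopES tf ε s x).label (G.curlLoop tf ε) = x := if_pos rfl

/-- Off the loop, `curlLoopES s x` is labelled as `s`. [folklore] -/
theorem curlLoopES_label_of_ne (s : G.EnhancedState) (x : Bool) {a : (G.curl tf ε).Arc}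
    (ha : a ≠ G.curlLoop tf ε) : (curlLoopES tf ε s x).label a = s.label (G.curlProj tf ε a) :=
  if_neg ha

/-- The label of `curlLoopES s x` on a lifted arc. [folklore] -/
@[simp]
theorem curlLoopES_label_curlLift (s : G.EnhancedState) (x : Bool) (a : G.Arc) :
    (curlLoopES tf ε s x).label (G.curlLift tf ε a) = s.label a := by
  rw [curlLoopES_label_of_ne tf ε s x (G.curlLift_ne_curlLoop tf ε a), curlProj_curlLift]

/-- The state of `curlThruES s`. [folklore] -/
@[simp]
theorem curlThruES_state (s : G.EnhancedState) :
    (curlThruES tf ε s).state = G.curlState tf ε s.state (!curlSeifBit ε) := rfl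

/-- The labels of `curlThruES s`. [folklore] -/
@[simp]
theorem curlThruES_label (s : G.EnhancedState) (a : (G.curl tf ε).Arc) :
    (curlThruES tf ε s).label a = s.label (G.curlProj tf ε a) := rfl

/-- The state of `curlProjES s'`. [folklore] -/
@[simp]
theorem curlProjES_state (s' : (G.curl tf ε).EnhancedState) (j : Fin G.n) :
    (curlProjES tf ε s').state j = s'.state j.castSucc := rfl

/-- The labels of `curlProjES s'`. [folklore] -/
@[simp]
theorem curlProjES_label (s' : (G.curl tf ε).EnhancedState) (a : G.Arc) :
    (curlProjES tf ε s').label a = s'.label (G.curlLift tf ε a) := rfl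

/-- The smoothing of the curl in `curlLoopES s x` is Seifert's. [folklore] -/
@[simp]
theorem curlLoopES_state_last (s : G.EnhancedState) (x : Bool) :
    (curlLoopES tf ε s x).state (Fin.last G.n) = curlSeifBit ε :=
  G.curlState_last tf ε _ _

/-- The smoothing of the curl in `curlThruES s` is not Seifert's. [folklore] -/
@[simp]
theorem curlThruES_state_last (s : G.EnhancedState) :
    (curlThruES tf ε s).state (Fin.last G.n) = !curlSeifBit ε :=
  G.curlState_last tf ε _ _

/-- `curlLoopES` and `curlThruES` states differ (at the curl chord). [folklore] -/
theorem curlLoopES_ne_curlThruES (s t : G.EnhancedState) (x : Bool) :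
    curlLoopES tf ε s x ≠ curlThruES tf ε t := fun h ↦ by
  have h1 := congrArg (fun u : (G.curl tf ε).EnhancedState ↦ u.state (Fin.last G.n)) h
  simp only [curlLoopES_state_last, curlThruES_state_last] at h1
  cases hb : curlSeifBit ε <;> rw [hb] at h1 <;> exact Bool.noConfusion h1

/-- Projecting `curlLoopES s x` gives back `s`. [folklore] -/
@[simp]
theorem curlProjES_curlLoopES (s : G.EnhancedState) (x : Bool) :
    curlProjES tf ε (curlLoopES tf ε s x) = s :=
  EnhancedState.ext' (funext fun j ↦ by simp) (funext fun a ↦ by simp)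

/-- Projecting `curlThruES s` gives back `s`. [folklore] -/
@[simp]
theorem curlProjES_curlThruES (s : G.EnhancedState) : curlProjES tf ε (curlThruES tf ε s) = s :=
  EnhancedState.ext' (funext fun j ↦ by simp) (funext fun a ↦ by simp)

/-- An enhanced state of the curled diagram with the curl resolved à la Seifert is `curlLoopES` of
its projection and of the label of its loop. [folklore] -/
theorem curlLoopES_curlProjES (s' : (G.curl tf ε).EnhancedState)
    (hs : s'.state (Fin.last G.n) = curlSeifBit ε) :
    curlLoopES tf ε (curlProjES tf ε s') (s'.label (G.curlLoop tf ε)) = s' := by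
  have hst : G.curlState tf ε (curlProjES tf ε s').state (curlSeifBit ε) = s'.state := by
    rw [← hs]; exact (G.eq_curlState tf ε s'.state).symm
  refine EnhancedState.ext' hst (funext fun a ↦ ?_)
  by_cases ha : a = G.curlLoop tf ε
  · rw [ha, curlLoopES_label_curlLoop]
  · rw [curlLoopES_label_of_ne tf ε _ _ ha, curlProjES_label]
    apply s'.label_eq_of_reachable
    rw [← hst]
    exact G.reachable_curlLift_curlProj tf ε _ _ ha

/-- An enhanced state of the curled diagram with the curl resolved against Seifert is `curlThruES`
of its projection. [folklore] -/
theorem curlThruES_curlProjES (s' : (G.curl tf ε).EnhancedState)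
    (hs : s'.state (Fin.last G.n) = !curlSeifBit ε) : curlThruES tf ε (curlProjES tf ε s') = s' := by
  have hst : G.curlState tf ε (curlProjES tf ε s').state (!curlSeifBit ε) = s'.state := by
    rw [← hs]; exact (G.eq_curlState tf ε s'.state).symm
  refine EnhancedState.ext' hst (funext fun a ↦ ?_)
  rw [curlThruES_label, curlProjES_label]
  apply s'.label_eq_of_reachable
  rw [← hst]
  exact G.reachable_curlLift_curlProj_of_not_seif tf ε _ _ (curlSeif_not_curlSeifBit ε) a

/-- The smoothing of the curl chord of an enhanced state of the curled diagram is Seifert's or the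
other one. [folklore] -/
theorem state_last_eq_or (s' : (G.curl tf ε).EnhancedState) :
    s'.state (Fin.last G.n) = curlSeifBit ε ∨ s'.state (Fin.last G.n) = !curlSeifBit ε := by
  cases s'.state (Fin.last G.n) <;> cases curlSeifBit ε <;> simp

variable (G) in
/-- **The enhanced states of the curled diagram**: those with the curl resolved à la Seifert are
the `curlLoopES s x` (an enhanced state of `G` and a label of the loop), the others are the
`curlThruES s`: `ES(G.curl) ≃ ES(G) × Bool ⊕ ES(G)`. As groups,
`C(D') = C(D ⊔ ○) ⊕ C(D) = C(D) ⊗ A ⊕ C(D)`. Khovanov (2000), §5.1–5.2; Bar-Natan (2002), §4.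
[cite: Khovanov2000, §5.1] -/
def curlESEquiv : (G.curl tf ε).EnhancedState ≃ (G.EnhancedState × Bool) ⊕ G.EnhancedState where
  toFun s' := if s'.state (Fin.last G.n) = curlSeifBit ε then
      Sum.inl (curlProjES tf ε s', s'.label (G.curlLoop tf ε)) else Sum.inr (curlProjES tf ε s')
  invFun := Sum.elim (fun p ↦ curlLoopES tf ε p.1 p.2) (fun s ↦ curlThruES tf ε s)
  left_inv s' := by
    rcases state_last_eq_or tf ε s' with hs | hs
    · simp only [hs, ↓reduceIte, Sum.elim_inl]
      exact curlLoopES_curlProjES tf ε s' hs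
    · have hs' : ¬ s'.state (Fin.last G.n) = curlSeifBit ε := by
        rw [hs]; cases curlSeifBit ε <;> simp
      simp only [hs', ↓reduceIte, Sum.elim_inr]
      exact curlThruES_curlProjES tf ε s' hs
  right_inv := by
    rintro (⟨s, x⟩ | s)
    · simp
    · have h : ¬ (!curlSeifBit ε) = curlSeifBit ε := by cases curlSeifBit ε <;> simp
      simp [h]

/-- `curlESEquiv` on a `curlLoopES`. [folklore] -/
@[simp]
theorem curlESEquiv_curlLoopES (s : G.EnhancedState) (x : Bool) :
    G.curlESEquiv tf ε (curlLoopES tf ε s x) = Sum.inl (s, x) :=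
  (G.curlESEquiv tf ε).apply_eq_iff_eq_symm_apply.2 rfl

/-- `curlESEquiv` on a `curlThruES`. [folklore] -/
@[simp]
theorem curlESEquiv_curlThruES (s : G.EnhancedState) :
    G.curlESEquiv tf ε (curlThruES tf ε s) = Sum.inr s :=
  (G.curlESEquiv tf ε).apply_eq_iff_eq_symm_apply.2 rfl

/-- `curlLoopES` is injective. [folklore] -/
theorem curlLoopES_injective : Injective (fun p : G.EnhancedState × Bool ↦ curlLoopES tf ε p.1 p.2) :=
  fun p q h ↦ Sum.inl_injective (β := G.EnhancedState) (by
    simpa using congrArg (G.curlESEquiv tf ε) (h : curlLoopES tf ε p.1 p.2 = curlLoopES tf ε q.1 q.2))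

/-- `curlThruES` is injective. [folklore] -/
theorem curlThruES_injective : Injective (curlThruES tf ε (G := G)) := fun s t h ↦
  Sum.inr_injective (α := G.EnhancedState × Bool) (by simpa using congrArg (G.curlESEquiv tf ε) h)

/-- `curlLoopES s x = curlLoopES t y` iff `s = t` and `x = y`. [folklore] -/
@[simp]
theorem curlLoopES_eq_iff {s t : G.EnhancedState} {x y : Bool} :
    curlLoopES tf ε s x = curlLoopES tf ε t y ↔ s = t ∧ x = y := by
  constructor
  · intro h
    have := curlLoopES_injective tf ε (a₁ := (s, x)) (a₂ := (t, y)) h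
    simpa [Prod.mk.injEq] using this
  · rintro ⟨rfl, rfl⟩; rfl

/-- `curlThruES s = curlThruES t` iff `s = t`. [folklore] -/
@[simp]
theorem curlThruES_eq_iff {s t : G.EnhancedState} : curlThruES tf ε s = curlThruES tf ε t ↔ s = t :=
  (curlThruES_injective tf ε).eq_iff

/-- Every enhanced state of the curled diagram is a `curlLoopES` or a `curlThruES`. [folklore] -/
theorem eq_curlLoopES_or_eq_curlThruES (s' : (G.curl tf ε).EnhancedState) :
    (∃ s x, s' = curlLoopES tf ε s x) ∨ ∃ s, s' = curlThruES tf ε s := by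
  rcases state_last_eq_or tf ε s' with hs | hs
  · exact Or.inl ⟨_, _, (curlLoopES_curlProjES tf ε s' hs).symm⟩
  · exact Or.inr ⟨_, (curlThruES_curlProjES tf ε s' hs).symm⟩

/-! ## State circles and their labels -/

variable (G)

/-- **Resolving the curl against Seifert changes no state circle**: the state circles of
`curlState σ (!curlSeifBit ε)` are those of `σ` (through the projection of arcs).
Khovanov (2000), §5.1 (`D'(1) = D`). [cite: Khovanov2000, §5.1] -/
def curlThruCircleEquiv (σ : G.State) :
    (G.curl tf ε).StateCircle (G.curlState tf ε σ (!curlSeifBit ε)) ≃ G.StateCircle σ where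
  toFun := SimpleGraph.ConnectedComponent.lift (fun a' ↦ G.circleOf σ (G.curlProj tf ε a'))
    (fun _ _ p _ ↦ circleOf_eq_iff.2 (G.reachable_curlProj tf ε σ _ ⟨p⟩))
  invFun := SimpleGraph.ConnectedComponent.lift
    (fun a ↦ (G.curl tf ε).circleOf (G.curlState tf ε σ (!curlSeifBit ε)) (G.curlLift tf ε a))
    (fun a b p _ ↦ circleOf_eq_iff.2 (G.reachable_curl_of_reachable tf ε σ _ ⟨p⟩
      (G.curlLift_ne_curlLoop tf ε a) (G.curlLift_ne_curlLoop tf ε b) (by simp) (by simp)))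
  left_inv C' := by
    induction C' using SimpleGraph.ConnectedComponent.ind with | h a' => ?_
    change (G.curl tf ε).circleOf _ (G.curlLift tf ε (G.curlProj tf ε a')) = (G.curl tf ε).circleOf _ a'
    exact circleOf_eq_iff.2
      (G.reachable_curlLift_curlProj_of_not_seif tf ε σ _ (curlSeif_not_curlSeifBit ε) a')
  right_inv C := by
    induction C using SimpleGraph.ConnectedComponent.ind with | h a => ?_
    change G.circleOf σ (G.curlProj tf ε (G.curlLift tf ε a)) = G.circleOf σ a
    rw [curlProj_curlLift]

/-- `curlThruCircleEquiv` sends the circle of an arc to the circle of its projection. [folklore] -/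
@[simp]
theorem curlThruCircleEquiv_circleOf (σ : G.State) (a' : (G.curl tf ε).Arc) :
    G.curlThruCircleEquiv tf ε σ ((G.curl tf ε).circleOf (G.curlState tf ε σ (!curlSeifBit ε)) a') =
      G.circleOf σ (G.curlProj tf ε a') := rfl

/-- **Resolving the curl à la Seifert adds one state circle, the loop**: the state circles of
`curlState σ (curlSeifBit ε)` are those of `σ` together with the loop.
Khovanov (2000), §5.1 (`D'(0) = D ⊔ ○`). [cite: Khovanov2000, §5.1] -/
def curlLoopCircleEquiv (σ : G.State) :
    (G.curl tf ε).StateCircle (G.curlState tf ε σ (curlSeifBit ε)) ≃ Option (G.StateCircle σ) where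
  toFun := SimpleGraph.ConnectedComponent.lift
    (fun a' ↦ if a' = G.curlLoop tf ε then none else some (G.circleOf σ (G.curlProj tf ε a')))
    (fun a' b' p _ ↦ by
      obtain ⟨h1, h2⟩ := (G.circleOf_curl_eq_iff_of_seif tf ε σ _ (curlSeif_curlSeifBit ε) a' b').1
        (circleOf_eq_iff.2 ⟨p⟩)
      by_cases ha : a' = G.curlLoop tf ε
      · rw [if_pos ha, if_pos (h1.1 ha)]
      · rw [if_neg ha, if_neg (fun h ↦ ha (h1.2 h)), h2 ha])
  invFun o := o.elim ((G.curl tf ε).circleOf (G.curlState tf ε σ (curlSeifBit ε)) (G.curlLoop tf ε))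
    (SimpleGraph.ConnectedComponent.lift
      (fun a ↦ (G.curl tf ε).circleOf (G.curlState tf ε σ (curlSeifBit ε)) (G.curlLift tf ε a))
      (fun a b p _ ↦ circleOf_eq_iff.2 (G.reachable_curl_of_reachable tf ε σ _ ⟨p⟩
        (G.curlLift_ne_curlLoop tf ε a) (G.curlLift_ne_curlLoop tf ε b) (by simp) (by simp))))
  left_inv C' := by
    induction C' using SimpleGraph.ConnectedComponent.ind with | h a' => ?_
    by_cases ha : a' = G.curlLoop tf ε
    · subst ha
      simp only [SimpleGraph.ConnectedComponent.lift_mk, ↓reduceIte, Option.elim_none]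
      rfl
    · simp only [SimpleGraph.ConnectedComponent.lift_mk, ha, ↓reduceIte, Option.elim_some]
      change (G.curl tf ε).circleOf _ (G.curlLift tf ε (G.curlProj tf ε a')) = (G.curl tf ε).circleOf _ a'
      exact circleOf_eq_iff.2 (G.reachable_curlLift_curlProj tf ε σ _ ha)
  right_inv o := by
    rcases o with _ | C
    · simp only [Option.elim_none]
      change (if G.curlLoop tf ε = G.curlLoop tf ε then none else _) = none
      rw [if_pos rfl]
    · induction C using SimpleGraph.ConnectedComponent.ind with | h a => ?_
      simp only [Option.elim_some, SimpleGraph.ConnectedComponent.lift_mk]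
      change (if G.curlLift tf ε a = G.curlLoop tf ε then none
        else some (G.circleOf σ (G.curlProj tf ε (G.curlLift tf ε a)))) = some (G.circleOf σ a)
      rw [if_neg (G.curlLift_ne_curlLoop tf ε a), curlProj_curlLift]

/-- `curlLoopCircleEquiv` sends the loop's circle to `none`. [folklore] -/
@[simp]
theorem curlLoopCircleEquiv_circleOf_curlLoop (σ : G.State) :
    G.curlLoopCircleEquiv tf ε σ
      ((G.curl tf ε).circleOf (G.curlState tf ε σ (curlSeifBit ε)) (G.curlLoop tf ε)) = none := by
  change (if G.curlLoop tf ε = G.curlLoop tf ε then none else _) = none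
  rw [if_pos rfl]

/-- `curlLoopCircleEquiv` sends the circle of an arc off the loop to the circle of its projection.
[folklore] -/
theorem curlLoopCircleEquiv_circleOf_of_ne (σ : G.State) {a' : (G.curl tf ε).Arc}
    (ha : a' ≠ G.curlLoop tf ε) :
    G.curlLoopCircleEquiv tf ε σ ((G.curl tf ε).circleOf (G.curlState tf ε σ (curlSeifBit ε)) a') =
      some (G.circleOf σ (G.curlProj tf ε a')) := by
  change (if a' = G.curlLoop tf ε then none else _) = _
  rw [if_neg ha]

variable {G}

/-- The labels of the circles of `curlThruES s` are those of `s`. [folklore] -/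
theorem circleLabel_curlThruES (s : G.EnhancedState)
    (C' : (G.curl tf ε).StateCircle (curlThruES tf ε s).state) :
    circleLabel (curlThruES tf ε s) C' = circleLabel s (G.curlThruCircleEquiv tf ε s.state C') := by
  induction C' using SimpleGraph.ConnectedComponent.ind with | h a' => ?_
  rfl

/-- The labels of the circles of `curlLoopES s x`: `x` on the loop, those of `s` elsewhere.
[folklore] -/
theorem circleLabel_curlLoopES (s : G.EnhancedState) (x : Bool)
    (C' : (G.curl tf ε).StateCircle (curlLoopES tf ε s x).state) :
    circleLabel (curlLoopES tf ε s x) C' =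
      (G.curlLoopCircleEquiv tf ε s.state C').elim x (circleLabel s) := by
  induction C' using SimpleGraph.ConnectedComponent.ind with | h a' => ?_
  change (curlLoopES tf ε s x).label a' = (G.curlLoopCircleEquiv tf ε s.state
    ((G.curl tf ε).circleOf (G.curlState tf ε s.state (curlSeifBit ε)) a')).elim x (circleLabel s)
  by_cases ha : a' = G.curlLoop tf ε
  · subst ha
    rw [curlLoopCircleEquiv_circleOf_curlLoop]
    exact curlLoopES_label_curlLoop tf ε s x
  · rw [G.curlLoopCircleEquiv_circleOf_of_ne tf ε s.state ha]
    exact curlLoopES_label_of_ne tf ε s x ha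

/-! ## Degrees -/

/-- The indicator of a negative curl is that of Seifert's smoothing being `1`. [folklore] -/
theorem ite_curlSeifBit (ε : ℤˣ) :
    (if curlSeifBit ε then 1 else 0 : ℕ) = if ε = -1 then 1 else 0 := by
  rcases Int.units_eq_one_or ε with rfl | rfl <;> decide

/-- The indicator of a positive curl is that of Seifert's smoothing being `0`. [folklore] -/
theorem ite_not_curlSeifBit (ε : ℤˣ) :
    (if (!curlSeifBit ε) then 1 else 0 : ℕ) = if ε = 1 then 1 else 0 := by
  rcases Int.units_eq_one_or ε with rfl | rfl <;> decide

/-- `(ε : ℤ)` is the difference of the indicators of `ε = 1` and `ε = -1`. [folklore] -/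
theorem ite_sub_ite_eq_units (ε : ℤˣ) :
    (if ε = 1 then (1 : ℤ) else 0) - (if ε = -1 then (1 : ℤ) else 0) = ε := by
  rcases Int.units_eq_one_or ε with rfl | rfl <;> decide

/-- **The homological degree of `curlLoopES s x` is that of `s`**: Seifert's smoothing of the curl
is `1` exactly when the curl is negative, and then `n₋` grows by one as well. Khovanov (2000),
§5.1–5.2; Bar-Natan (2002), §4. [cite: Khovanov2000, §5.1] -/
theorem homDegree_curlLoopES (s : G.EnhancedState) (x : Bool) :
    homDegree (curlLoopES tf ε s x) = homDegree s := by
  simp only [homDegree, curlLoopES_state, weight_curlState, nMinus_curl, ite_curlSeifBit]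
  push_cast
  ring

/-- **The homological degree of `curlThruES s` is that of `s` plus `ε`.** Khovanov (2000),
§5.1–5.2; Bar-Natan (2002), §4. [cite: Khovanov2000, §5.1] -/
theorem homDegree_curlThruES (s : G.EnhancedState) :
    homDegree (curlThruES tf ε s) = homDegree s + ε := by
  simp only [homDegree, curlThruES_state, weight_curlState, nMinus_curl, ite_not_curlSeifBit]
  push_cast
  linear_combination ite_sub_ite_eq_units ε

/-- **The quantum degree of `curlThruES s` is that of `s` plus `2ε`** (no circle changes; `|s|`
and `n₊`, or `n₋`, change). Khovanov (2000), §5.1–5.2; Bar-Natan (2002), §4. [cite: Khovanov2000, §5.1] -/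
theorem qDegree_curlThruES (s : G.EnhancedState) :
    qDegree (curlThruES tf ε s) = qDegree s + 2 * ε := by
  have hsum : ∑ C', labelDeg (circleLabel (curlThruES tf ε s) C') =
      ∑ C, labelDeg (circleLabel s C) :=
    Fintype.sum_equiv (G.curlThruCircleEquiv tf ε s.state) _ _
      (fun C' ↦ by rw [circleLabel_curlThruES])
  rw [qDegree_eq_sum_circleLabel, qDegree_eq_sum_circleLabel, hsum]
  simp only [curlThruES_state, weight_curlState, nPlus_curl, nMinus_curl, ite_not_curlSeifBit]
  push_cast
  linear_combination (2 : ℤ) * ite_sub_ite_eq_units ε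

/-- **The quantum degree of `curlLoopES s x` is that of `s` plus `deg x + ε`** (`deg 1 = 1`,
`deg X = -1` for the new loop; `|s|` and `n₊`, or `n₋`, change). Khovanov (2000), §5.1–5.2;
Bar-Natan (2002), §4. [cite: Khovanov2000, §5.1] -/
theorem qDegree_curlLoopES (s : G.EnhancedState) (x : Bool) :
    qDegree (curlLoopES tf ε s x) = qDegree s + labelDeg x + ε := by
  have hsum : ∑ C', labelDeg (circleLabel (curlLoopES tf ε s x) C') =
      ∑ o : Option (G.StateCircle s.state), labelDeg (o.elim x (circleLabel s)) :=
    Fintype.sum_equiv (G.curlLoopCircleEquiv tf ε s.state) _ _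
      (fun C' ↦ by rw [circleLabel_curlLoopES])
  rw [qDegree_eq_sum_circleLabel, qDegree_eq_sum_circleLabel, hsum, Fintype.sum_option]
  simp only [Option.elim_none, Option.elim_some, curlLoopES_state, weight_curlState, nPlus_curl,
    nMinus_curl, ite_curlSeifBit]
  push_cast
  linear_combination ite_sub_ite_eq_units ε

end GaussDiagram

end Literature.Topology.FourManifolds
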